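import Mathlib
import Summits.Ventures.HodgeRepro.Tier4.Line1.AdicIntegersCompact
import Summits.Ventures.HodgeRepro.Tier4.Line1.LocalFibration

/-!
# LINE L1 (t4-L1-p1) — C7.1 / C7.1∞ at the places of `k`: the local fields are locally compact and σ-compact

`Tier4/Line1/LocalFieldTopology.lean`.  The instances that `LocalFibration.exists_compact_stab_mul_of_transitive`
needs at a finite place `k_v = v.adicCompletion k` (locally compact: `𝓞_v` is a compact open subgroup, p5's
`compactSpace_adicCompletionIntegers`; σ-compact: `k_v = ⋃_{a ∈ k} (a + 𝓞_v)`, `k` countable and dense) and at an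
infinite place `k_w = w.Completion` (isometric to `ℝ` or `ℂ`, hence σ-compact), and the two corollaries
`exists_compact_local_stab_mul_fin_of_transitive` / `…_inf_of_transitive`: p4's C7.1 / C7.1∞ (C7 census S12903, with
`localU W v` / `localUInf W w` and `finRat` / `infRat` unfolded) follow from the transitivity of the local unitary group
on the sphere of `v₀` — local Witt is the whole residual.

HC_CM is NOT proved by anyone in this repository.
-/

namespace Summit.Ventures.HodgeRepro.Tier4.Line1

open NumberField IsDedekindDomain HeightOneSpectrum Topology Matrix

section Places

variable (k : Type) [Field k] [NumberField k]

/-- A number field is countable (a finite-dimensional `ℚ`-vector space). -/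
theorem countable_of_numberField_finrank : Countable k :=
  (Module.finBasis ℚ k).equivFun.injective.countable

/-- **`k_v` is locally compact**: `𝓞_v` is a compact open neighbourhood of `0`. -/
theorem locallyCompactSpace_adicCompletion (v : HeightOneSpectrum (𝓞 k)) :
    LocallyCompactSpace (v.adicCompletion k) := by
  haveI := compactSpace_adicCompletionIntegers k v
  have hK : IsCompact ((v.adicCompletionIntegers k : Set (v.adicCompletion k))) :=
    isCompact_iff_compactSpace.mpr ‹_›
  exact hK.locallyCompactSpace_of_mem_nhds_of_addGroup
    ((Valued.isOpen_valuationSubring (v.adicCompletion k)).mem_nhds (zero_mem _))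

/-- **`k_v` is σ-compact**: `k_v = ⋃_{a ∈ k} (a + 𝓞_v)` — every coset of the open subgroup `𝓞_v` meets the dense
subfield `k`, and `k` is countable. -/
theorem sigmaCompactSpace_adicCompletion (v : HeightOneSpectrum (𝓞 k)) :
    SigmaCompactSpace (v.adicCompletion k) := by
  haveI := compactSpace_adicCompletionIntegers k v
  haveI := countable_of_numberField_finrank k
  have hK : IsCompact ((v.adicCompletionIntegers k : Set (v.adicCompletion k))) :=
    isCompact_iff_compactSpace.mpr ‹_›
  refine SigmaCompactSpace.of_countable
    (Set.range fun a : k => (fun x => algebraMap k (v.adicCompletion k) a + x) ''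
      (v.adicCompletionIntegers k : Set (v.adicCompletion k))) (Set.countable_range _) ?_ ?_
  · rintro s ⟨a, rfl⟩
    exact hK.image (continuous_const.add continuous_id)
  · apply Set.eq_univ_of_forall
    intro x
    have hopen : IsOpen {y : v.adicCompletion k | x - y ∈
        (v.adicCompletionIntegers k : Set (v.adicCompletion k))} :=
      (Valued.isOpen_valuationSubring (v.adicCompletion k)).preimage (continuous_const.sub continuous_id)
    have hne : ({y : v.adicCompletion k | x - y ∈
        (v.adicCompletionIntegers k : Set (v.adicCompletion k))}).Nonempty :=
      ⟨x, by simp⟩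
    obtain ⟨a, ha⟩ := (denseRange_algebraMap k v).exists_mem_open hopen hne
    refine Set.mem_sUnion.2 ⟨_, ⟨a, rfl⟩, x - algebraMap k (v.adicCompletion k) a, ha, ?_⟩
    simp

omit [NumberField k] in
/-- **`k_w` is σ-compact**: isometric to `ℝ` (real place) or `ℂ` (complex place). -/
theorem sigmaCompactSpace_infinitePlaceCompletion (w : InfinitePlace k) :
    SigmaCompactSpace w.Completion := by
  rcases w.isReal_or_isComplex with hw | hw
  · exact (InfinitePlace.Completion.isometryEquivRealOfIsReal hw).toHomeomorph.isClosedEmbedding.sigmaCompactSpace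
  · exact (InfinitePlace.Completion.isometryEquivComplexOfIsComplex
      hw).toHomeomorph.isClosedEmbedding.sigmaCompactSpace

end Places

end Summit.Ventures.HodgeRepro.Tier4.Line1
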